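import Literature.NumberTheory.Rogawski1990.AdelicStableOrbitalSupportFiniteH
import HarnessLib

/-!
# The `G′`-adelic stable class over `γ_H` meets a compact set in finitely many `G′(𝐀)`-classes; `Σ_{𝒞_𝐀(G′)} Φ(δ, f′)` and the `κ`-twisted sums
# `Σ κ(obs δ) Φ(δ, f′)` are finitely supported (Rogawski 1990, §3.3 p. 21, §4.3 (4.3.3) p. 44, §5.4 pp. 72–73; Kottwitz 1986 = [Kt₄], Prop. 7.1)

Topic `NumberTheory/Rogawski1990`; namespace `Literature.NumberTheory.Rogawski1990`; THEOREMS ONLY (no definition, no instance, no named fact, no `sorry`).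
The THIRD twin of ★ `AdelicStableOrbitalSupportFinite` (`G = U(Φ₃)`) ∕ ★ `AdelicStableOrbitalSupportFiniteH` (`H`): the INNER FORM `G′ = U(H′)` and the carrier
★ `MatchingAdele L H′ γH` (★ T1b-9 `AdelicStableConjugacy`: `G′`-adèles norm-matching a rational `γ_H ∈ H(L⁺)`) ∕ ★ `adelicStableClassesOver L H′ γH` (typer brick
★ `AdelicStableOrbitalIntegral`: the index set of `Φ^{st,𝐀}_{G′}` and of the `κ`-twisted `Σ_{δ ∈ 𝒞_𝐀} κ(obs δ) Φ(δ, f′)` of (4.3.3) ∕ (5.4.2)).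

What changes on the `G′`-side: the base point at a finite place is the image `ι_v((γ_H)_v) ∈ U(Φ₃)(L⁺_v)` of ★ `endoEmbLocal` — an element of ANOTHER unitary group
(★ p02's `finite_image_conjClassesMk_inter_corresponds_local ∕ _archCM` allow exactly that) — and there need not be a rational base point in `G′` (the stable class of
`γ_H` need not transfer to the inner form), so the a.e. integral conjugacy of [Kt₄] Prop. 7.1 is taken in its RELATIVE form: two elements of `K′_v` both matching
`(γ_H)_v` are `K′_v`-conjugate, for almost all `v` — as a HYPOTHESIS `hP` (the kernel-lane discharges of [Kt₄] 7.1 in flight supply it); regularity of the base points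
comes from `G`-regularity of `γ_H` (★ `IsGRegular`) pushed along ★ `toLocal_endoEmbAdelic` ∕ ★ `toAdelic_endoEmbRational` ∕ ★ `map_endoGL`.

* §1 `MatchingAdele.exists_adele_eq_of_isConj` (saturation), `isRegularElt_endoEmbLocal_rationalComponent`, `isRegularElt_endoEmbArch_rationalArch`.
* §2 **`MatchingAdele.finite_setOf_mem_classes_inter_of_eventually`** — `{c ∈ adelicStableClassesOver L H′ γH | c ∩ C ≠ ∅}` is finite for compact `C ⊂ G′(𝐀)`.
* §3 **`MatchingAdele.finite_classes_inter_support_classOrbitalIntegral_of_eventually`** — `(adelicStableClassesOver L H′ γH ∩ support (classOrbitalIntegral m f′)).Finite`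
  for EVERY family `m` and EVERY `f′` with compact support; hence also for every weight `w` the `κ`-twisted summand `c ↦ w c * Φ_m(c, f′)`
  (`…_support_mul_…`): ★ `adelicStableOrbitalIntegralG'` and ★ `adelicKappaOrbitalIntegralG'` are honest finite sums.

## References
* J. D. Rogawski, *Automorphic Representations of Unitary Groups in Three Variables*, Ann. of Math. Stud. 123 (1990), §3.3 p. 21, §4.3 p. 44, §5.4 pp. 72–73
  [Rogawski1990].
* R. E. Kottwitz, *Stable trace formula: elliptic singular terms*, Math. Ann. 275 (1986), Prop. 7.1 [Kottwitz1986].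
* A. Borel, H. Jacquet, *Automorphic forms and automorphic representations*, Proc. Sympos. Pure Math. 33.1 (1979), §4.1 [BorelJacquet1979].
-/
noncomputable section

open NumberField IsDedekindDomain Filter Topology
open scoped Matrix MatrixGroups

namespace Literature.NumberTheory.Rogawski1990

open Literature.NumberTheory.Automorphic
open Literature.AlgebraicGeometry.ShimuraVarieties (unitaryGroup)

section FiniteGp

variable {L : Type} [Field L] [NumberField L] [IsCMField L] {H' : Matrix (Fin 3) (Fin 3) L}
variable {γH : (UnitaryGroup.cmDatum L 2 (Matrix.of fun i j : Fin 2 => if i.val + j.val + 1 = 2 then (1 : L) else 0)).Rational × (UnitaryGroup.cmDatum L 1 (Matrix.of fun i j : Fin 1 => if i.val + j.val + 1 = 1 then (1 : L) else 0)).Rational}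

/-! ## §1 Saturation; regularity of the base points `ι_v((γ_H)_v)`, `ι_∞(γ_H ⊗ 1)` -/

/-- **Saturation**: a `G′(𝐀)`-conjugate of a matching adèle over `γ_H` is matching (conjugacy at each place implies stable conjugacy there, and `→`
is constant on stable classes, ★ `Corresponds.of_isStablyConj_right`). [cite: Rogawski1990, §5.4 p. 72] -/
theorem MatchingAdele.exists_adele_eq_of_isConj (p : MatchingAdele L H' γH) {g : (UnitaryGroup.cmDatum L 3 H').Adelic} (hc : IsConj p.adele g) :
    ∃ q : MatchingAdele L H' γH, q.adele = g :=
  ⟨⟨g, fun v => (p.isLocalNormPair v).of_isStablyConj_right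
      (isStablyConj_of_isConj (((UnitaryGroup.cmDatum L 3 H').toLocal v).map_isConj hc)),
    p.isArchNormPair.of_isStablyConj_right
      (isStablyConj_of_isConj ((UnitaryGroup.archPart (↥(maximalRealSubfield L)) L (IsCMField.complexConj L) 3 H').map_isConj hc))⟩, rfl⟩

/-- `c ∈ 𝒞_𝐀(γ_H)` and `mk g = c` ⇒ `g` is a matching adèle. [cite: Rogawski1990, §5.4 p. 72] -/
theorem exists_matchingAdele_adele_eq_of_mem {c : ConjClasses (UnitaryGroup.cmDatum L 3 H').Adelic} (hc : c ∈ adelicStableClassesOver L H' γH)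
    {g : (UnitaryGroup.cmDatum L 3 H').Adelic} (hg : ConjClasses.mk g = c) : ∃ q : MatchingAdele L H' γH, q.adele = g := by
  obtain ⟨p, rfl⟩ := hc
  exact p.exists_adele_eq_of_isConj (ConjClasses.mk_eq_mk_iff_isConj.1 hg.symm)

/-- **`G`-regularity of `γ_H` localises**: `ι_v((γ_H)_v) ∈ U(Φ₃)(L⁺_v)` (★ `endoEmbLocal` at ★ `rationalComponent`) is regular semisimple — it is the `v`-component of
`toAdelic (ι γ_H)` (★ `toAdelic_endoEmbRational`, ★ `toLocal_endoEmbAdelic`) and regularity passes to base changes (★ `IsRegularElt.map`). [cite: Rogawski1990, §4.3 p. 42] -/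
theorem isRegularElt_endoEmbLocal_rationalComponent
    (hreg : IsGRegular (cmConjRingHom L) (Matrix.of fun i j : Fin 2 => if i.val + j.val + 1 = 2 then (1 : L) else 0) (Matrix.of fun i j : Fin 1 => if i.val + j.val + 1 = 1 then (1 : L) else 0) (Matrix.of fun i j : Fin 3 => if i.val + j.val + 1 = 3 then (1 : L) else 0) endoForm_antidiagOne γH) (v : HeightOneSpectrum (𝓞 ↥(maximalRealSubfield L))) :
    IsRegularElt ((endoEmbLocal L v (rationalComponent L γH v)).val : GL (Fin 3) (UnitaryGroup.LocalRing L v)) := by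
  have h : endoEmbLocal L v (rationalComponent L γH v) =
      (UnitaryGroup.cmDatum L 3 (Matrix.of fun i j : Fin 3 => if i.val + j.val + 1 = 3 then (1 : L) else 0)).toLocal v ((UnitaryGroup.cmDatum L 3 (Matrix.of fun i j : Fin 3 => if i.val + j.val + 1 = 3 then (1 : L) else 0)).toAdelic (endoEmbRational L γH)) := by
    rw [toAdelic_endoEmbRational, toLocal_endoEmbAdelic]
    rfl
  rw [h]
  exact ((show IsRegularElt ((endoEmbRational L γH).val : GL (Fin 3) L) from hreg).map (algebraMap L (AdeleRing (𝓞 L) L))).map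
    (UnitaryGroup.adeleToLocal L v)

/-- **`G`-regularity of `γ_H` at `∞`**: `ι_∞(γ_H ⊗ 1) ∈ U(Φ₃)(L ⊗ ℝ)` (★ `endoEmbArch` at ★ `rationalArch`) is regular semisimple (★ `map_endoGL` along
`mixedEmbedding`, ★ `IsRegularElt.map`). [cite: Rogawski1990, §4.3 p. 42; §14.3 p. 234] -/
theorem isRegularElt_endoEmbArch_rationalArch (hreg : IsGRegular (cmConjRingHom L) (Matrix.of fun i j : Fin 2 => if i.val + j.val + 1 = 2 then (1 : L) else 0) (Matrix.of fun i j : Fin 1 => if i.val + j.val + 1 = 1 then (1 : L) else 0) (Matrix.of fun i j : Fin 3 => if i.val + j.val + 1 = 3 then (1 : L) else 0) endoForm_antidiagOne γH) :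
    IsRegularElt ((endoEmbArch L (rationalArch L γH)).val : GL (Fin 3) (mixedEmbedding.mixedSpace L)) := by
  have h := (show IsRegularElt ((endoEmbRational L γH).val : GL (Fin 3) L) from hreg).map (mixedEmbedding L)
  rw [coe_endoEmbRational, map_endoGL] at h
  exact h

/-! ## §2 Only finitely many classes of `𝒞_𝐀(γ_H) ⊂ ConjClasses G′(𝐀)` meet a compact set -/

/-- **Only finitely many `G′(𝐀)`-classes of the adelic stable class over `γ_H` meet a compact set** (`G′ = U(H′)`, `H′` non-degenerate hermitian, `γ_H` `G`-regular;
the RELATIVE a.e. integral conjugacy of [Kt₄] Prop. 7.1 — two elements of `K′_v` matching `(γ_H)_v` are `K′_v`-conjugate, a.a. `v` — as the HYPOTHESIS `hP`):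
for `C ⊂ G′(𝐀)` compact, `{c ∈ 𝒞_𝐀(γ_H) | c ∩ C ≠ ∅}` is finite.  PROOF as for `G` and `H`: `C` is integral off a finite `S`
(★ `UnitaryGroup.exists_finset_forall_toLocal_mem_of_isCompact`); off `S ∪ S_bad` two matching components in `C` are `K′_v`-conjugate (`hP`); at the remaining places
and at `∞` finitely many `G′`-classes matching the regular `ι_v((γ_H)_v)` ∕ `ι_∞(γ_H ⊗ 1)` meet the compact image (★ `finite_image_conjClassesMk_inter_corresponds_local`
∕ `…_archCM`, base point in `U(Φ₃)`); a `G′(𝐀)`-class is determined by these data (gluing ★ `UnitaryGroup.isConj_of_isConj_archPart_of_forall_exists_conj` at `J = H′`).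
[cite: Rogawski1990, §3.3 p. 21; §4.3 p. 44; §5.4 p. 72] [cite: Kottwitz1986, Prop. 7.1] -/
theorem MatchingAdele.finite_setOf_mem_classes_inter_of_eventually (hH : (H'.map (cmConjRingHom L))ᵀ = H') (hdet : H'.det ≠ 0)
    (hreg : IsGRegular (cmConjRingHom L) (Matrix.of fun i j : Fin 2 => if i.val + j.val + 1 = 2 then (1 : L) else 0) (Matrix.of fun i j : Fin 1 => if i.val + j.val + 1 = 1 then (1 : L) else 0) (Matrix.of fun i j : Fin 3 => if i.val + j.val + 1 = 3 then (1 : L) else 0) endoForm_antidiagOne γH)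
    (hP : ∀ᶠ v in cofinite, ∀ g g' : (UnitaryGroup.cmDatum L 3 H').Local v,
      g ∈ UnitaryGroup.cmLocalIntegralLevel L 3 H' v → g' ∈ UnitaryGroup.cmLocalIntegralLevel L 3 H' v →
        IsLocalNormPair L H' v (rationalComponent L γH v) g → IsLocalNormPair L H' v (rationalComponent L γH v) g' →
          ∃ k ∈ UnitaryGroup.cmLocalIntegralLevel L 3 H' v, k * g * k⁻¹ = g')
    {C : Set (UnitaryGroup.cmDatum L 3 H').Adelic} (hC : IsCompact C) :
    {c : ConjClasses (UnitaryGroup.cmDatum L 3 H').Adelic | c ∈ adelicStableClassesOver L H' γH ∧ ∃ g ∈ C, ConjClasses.mk g = c}.Finite := by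
  classical
  -- (1) `C` is integral off a finite set `S`
  obtain ⟨S, hS⟩ := UnitaryGroup.exists_finset_forall_toLocal_mem_of_isCompact (↥(maximalRealSubfield L)) L (IsCMField.complexConj L) 3 H' hC
  -- (2) the bad places of the hypothesis
  have hTfin := Filter.eventually_cofinite.1 hP
  set T : Finset (HeightOneSpectrum (𝓞 ↥(maximalRealSubfield L))) := S ∪ hTfin.toFinset with hTdef
  have hTS : ∀ v ∉ T, v ∉ S := fun v hv h => hv (Finset.mem_union_left _ h)
  have hTP : ∀ v ∉ T, ∀ g g' : (UnitaryGroup.cmDatum L 3 H').Local v,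
      g ∈ UnitaryGroup.cmLocalIntegralLevel L 3 H' v → g' ∈ UnitaryGroup.cmLocalIntegralLevel L 3 H' v →
        IsLocalNormPair L H' v (rationalComponent L γH v) g → IsLocalNormPair L H' v (rationalComponent L γH v) g' →
          ∃ k ∈ UnitaryGroup.cmLocalIntegralLevel L 3 H' v, k * g * k⁻¹ = g' := by
    intro v hv
    by_contra hnot
    exact hv (Finset.mem_union_right _ (hTfin.mem_toFinset.2 hnot))
  -- (3) representatives IN `C`
  let rep : ConjClasses (UnitaryGroup.cmDatum L 3 H').Adelic → (UnitaryGroup.cmDatum L 3 H').Adelic := fun c =>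
    if h : ∃ g ∈ C, ConjClasses.mk g = c then h.choose else Quotient.out c
  have hrep : ∀ c, (∃ g ∈ C, ConjClasses.mk g = c) → rep c ∈ C ∧ ConjClasses.mk (rep c) = c := by
    intro c h
    simp only [rep, dif_pos h]
    exact h.choose_spec
  have hmatch : ∀ c, c ∈ adelicStableClassesOver L H' γH → (∃ g ∈ C, ConjClasses.mk g = c) → ∃ p : MatchingAdele L H' γH, p.adele = rep c :=
    fun c hc h => exists_matchingAdele_adele_eq_of_mem hc (hrep c h).2
  -- (4) finitely many local classes at each place, and at `∞`, meet the image of `C`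
  have hAv : ∀ v : HeightOneSpectrum (𝓞 ↥(maximalRealSubfield L)),
      (ConjClasses.mk '' {x : (UnitaryGroup.cmDatum L 3 H').Local v |
        x ∈ (UnitaryGroup.cmDatum L 3 H').toLocal v '' C ∧
          Corresponds (UnitaryGroup.conjLocal L (IsCMField.complexConj L) v) ((UnitaryGroup.adelicForm L 3 (Matrix.of fun i j : Fin 3 => if i.val + j.val + 1 = 3 then (1 : L) else 0)).map (UnitaryGroup.adeleToLocal L v))
            ((UnitaryGroup.adelicForm L 3 H').map (UnitaryGroup.adeleToLocal L v)) (endoEmbLocal L v (rationalComponent L γH v)) x}).Finite := fun v =>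
    UnitaryGroup.finite_image_conjClassesMk_inter_corresponds_local L 3 H' (Matrix.of fun i j : Fin 3 => if i.val + j.val + 1 = 3 then (1 : L) else 0) v hH hdet _ (isRegularElt_endoEmbLocal_rationalComponent hreg v)
      (hC.image ((UnitaryGroup.cmDatum L 3 H').continuous_toLocal v))
  have hAi : (ConjClasses.mk '' {x : UnitaryGroup.arch (↥(maximalRealSubfield L)) L (IsCMField.complexConj L) 3 H' |
      x ∈ UnitaryGroup.archPart (↥(maximalRealSubfield L)) L (IsCMField.complexConj L) 3 H' '' C ∧
        Corresponds (UnitaryGroup.conjMixed (↥(maximalRealSubfield L)) L (IsCMField.complexConj L)) (UnitaryGroup.archFormOf L 3 (Matrix.of fun i j : Fin 3 => if i.val + j.val + 1 = 3 then (1 : L) else 0)) (UnitaryGroup.archFormOf L 3 H')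
          (endoEmbArch L (rationalArch L γH)) x}).Finite :=
    UnitaryGroup.finite_image_conjClassesMk_inter_corresponds_archCM L 3 H' (Matrix.of fun i j : Fin 3 => if i.val + j.val + 1 = 3 then (1 : L) else 0) hH hdet _ (isRegularElt_endoEmbArch_rationalArch hreg)
      (hC.image (UnitaryGroup.continuous_archPart (↥(maximalRealSubfield L)) L (IsCMField.complexConj L) 3 H'))
  -- (5) the map «class ↦ (local classes at T, archimedean class)», with finite target on our set
  let Ψ : ConjClasses (UnitaryGroup.cmDatum L 3 H').Adelic →
      ((v : ↥T) → ConjClasses ((UnitaryGroup.cmDatum L 3 H').Local v.1)) × ConjClasses (UnitaryGroup.arch (↥(maximalRealSubfield L)) L (IsCMField.complexConj L) 3 H') := fun c =>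
    (fun v => ConjClasses.mk ((UnitaryGroup.cmDatum L 3 H').toLocal v.1 (rep c)), ConjClasses.mk (UnitaryGroup.archPart (↥(maximalRealSubfield L)) L (IsCMField.complexConj L) 3 H' (rep c)))
  have hfinTarget : (Set.pi Set.univ (fun v : ↥T => ConjClasses.mk '' {x : (UnitaryGroup.cmDatum L 3 H').Local v.1 |
        x ∈ (UnitaryGroup.cmDatum L 3 H').toLocal v.1 '' C ∧
          Corresponds (UnitaryGroup.conjLocal L (IsCMField.complexConj L) v.1) ((UnitaryGroup.adelicForm L 3 (Matrix.of fun i j : Fin 3 => if i.val + j.val + 1 = 3 then (1 : L) else 0)).map (UnitaryGroup.adeleToLocal L v.1))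
            ((UnitaryGroup.adelicForm L 3 H').map (UnitaryGroup.adeleToLocal L v.1)) (endoEmbLocal L v.1 (rationalComponent L γH v.1)) x}) ×ˢ
      (ConjClasses.mk '' {x : UnitaryGroup.arch (↥(maximalRealSubfield L)) L (IsCMField.complexConj L) 3 H' |
        x ∈ UnitaryGroup.archPart (↥(maximalRealSubfield L)) L (IsCMField.complexConj L) 3 H' '' C ∧
          Corresponds (UnitaryGroup.conjMixed (↥(maximalRealSubfield L)) L (IsCMField.complexConj L)) (UnitaryGroup.archFormOf L 3 (Matrix.of fun i j : Fin 3 => if i.val + j.val + 1 = 3 then (1 : L) else 0)) (UnitaryGroup.archFormOf L 3 H')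
            (endoEmbArch L (rationalArch L γH)) x})).Finite :=
    (Set.Finite.pi fun v => hAv v.1).prod hAi
  have hmaps : Set.MapsTo Ψ {c | c ∈ adelicStableClassesOver L H' γH ∧ ∃ g ∈ C, ConjClasses.mk g = c}
      (Set.pi Set.univ (fun v : ↥T => ConjClasses.mk '' {x : (UnitaryGroup.cmDatum L 3 H').Local v.1 |
        x ∈ (UnitaryGroup.cmDatum L 3 H').toLocal v.1 '' C ∧
          Corresponds (UnitaryGroup.conjLocal L (IsCMField.complexConj L) v.1) ((UnitaryGroup.adelicForm L 3 (Matrix.of fun i j : Fin 3 => if i.val + j.val + 1 = 3 then (1 : L) else 0)).map (UnitaryGroup.adeleToLocal L v.1))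
            ((UnitaryGroup.adelicForm L 3 H').map (UnitaryGroup.adeleToLocal L v.1)) (endoEmbLocal L v.1 (rationalComponent L γH v.1)) x}) ×ˢ
      (ConjClasses.mk '' {x : UnitaryGroup.arch (↥(maximalRealSubfield L)) L (IsCMField.complexConj L) 3 H' |
        x ∈ UnitaryGroup.archPart (↥(maximalRealSubfield L)) L (IsCMField.complexConj L) 3 H' '' C ∧
          Corresponds (UnitaryGroup.conjMixed (↥(maximalRealSubfield L)) L (IsCMField.complexConj L)) (UnitaryGroup.archFormOf L 3 (Matrix.of fun i j : Fin 3 => if i.val + j.val + 1 = 3 then (1 : L) else 0)) (UnitaryGroup.archFormOf L 3 H')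
            (endoEmbArch L (rationalArch L γH)) x})) := by
    rintro c ⟨hc, hgC⟩
    obtain ⟨p, hp⟩ := hmatch c hc hgC
    have hrc := (hrep c hgC).1
    refine Set.mk_mem_prod (Set.mem_univ_pi.2 fun v => ?_) ?_
    · refine ⟨(UnitaryGroup.cmDatum L 3 H').toLocal v.1 (rep c), ⟨⟨rep c, hrc, rfl⟩, ?_⟩, rfl⟩
      have h2 := p.isLocalNormPair v.1
      rw [hp] at h2
      exact (isLocalNormPair_iff L H' v.1 _ _).1 h2
    · refine ⟨UnitaryGroup.archPart (↥(maximalRealSubfield L)) L (IsCMField.complexConj L) 3 H' (rep c), ⟨⟨rep c, hrc, rfl⟩, ?_⟩, rfl⟩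
      have h2 := p.isArchNormPair
      rw [MatchingAdele.arch, hp] at h2
      exact (isArchNormPair_iff L H' _ _).1 h2
  -- (6) injectivity on our set: the GLUING LEMMA (relative integral conjugators off `T`)
  have hinj : Set.InjOn Ψ {c | c ∈ adelicStableClassesOver L H' γH ∧ ∃ g ∈ C, ConjClasses.mk g = c} := by
    rintro c ⟨hc, hgC⟩ c' ⟨hc', hgC'⟩ heq
    obtain ⟨p, hp⟩ := hmatch c hc hgC
    obtain ⟨p', hp'⟩ := hmatch c' hc' hgC'
    have hrc := hrep c hgC
    have hrc' := hrep c' hgC'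
    have hgood : ∀ v ∉ T, ∃ k ∈ UnitaryGroup.cmLocalIntegralLevel L 3 H' v,
        k * (UnitaryGroup.cmDatum L 3 H').toLocal v (rep c) * k⁻¹ = (UnitaryGroup.cmDatum L 3 H').toLocal v (rep c') := by
      intro v hv
      have h1 := p.isLocalNormPair v
      rw [hp] at h1
      have h1' := p'.isLocalNormPair v
      rw [hp'] at h1'
      exact hTP v hv _ _ (hS _ hrc.1 v (hTS v hv)) (hS _ hrc'.1 v (hTS v hv)) h1 h1'
    have hconj : IsConj (rep c) (rep c') := by
      refine UnitaryGroup.isConj_of_isConj_archPart_of_forall_exists_conj (↥(maximalRealSubfield L)) L (IsCMField.complexConj L) 3 H' ?_ (fun v => ?_) ?_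
      · exact ConjClasses.mk_eq_mk_iff_isConj.1 (congrArg Prod.snd heq)
      · by_cases hvT : v ∈ T
        · exact ConjClasses.mk_eq_mk_iff_isConj.1 (congrFun (congrArg Prod.fst heq) ⟨v, hvT⟩)
        · obtain ⟨k, -, hk⟩ := hgood v hvT
          exact isConj_iff.2 ⟨k, hk⟩
      · filter_upwards [T.finite_toSet.compl_mem_cofinite] with v hv
        obtain ⟨k, hk, hkeq⟩ := hgood v hv
        exact ⟨k, hk, hkeq⟩
    rw [← hrc.2, ← hrc'.2]
    exact ConjClasses.mk_eq_mk_iff_isConj.2 hconj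
  exact Set.Finite.of_finite_image (hfinTarget.subset hmaps.image_subset) hinj

/-! ## §3 `Σ_{δ ∈ 𝒞_𝐀(γ_H)} Φ(δ, f′)` and `Σ κ(obs δ) Φ(δ, f′)` are finite sums for every `f′ ∈ C_c(G′(𝐀))` and every family of orbital measures -/

/-- **The `G′`-adelic stable orbital sum over `γ_H` is finitely supported** — EVERY family `m` of orbital measures on the classes of `G′(𝐀) = U(H′)(𝔸_L)`, EVERY `f′` with
compact support (`H′` non-degenerate hermitian, `γ_H` `G`-regular, the relative a.e. integral conjugacy as hypothesis): `(𝒞_𝐀(γ_H) ∩ support (c ↦ Φ_m(c, f′))).Finite`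
(★ `orbitalIntegral_eq_zero_of_forall_notMem_tsupport` + §2).  So ★ `adelicStableOrbitalIntegralG'` is an honest finite sum. [cite: Rogawski1990, §4.3 p. 44; §5.4 p. 72] -/
theorem MatchingAdele.finite_classes_inter_support_classOrbitalIntegral_of_eventually (hH : (H'.map (cmConjRingHom L))ᵀ = H') (hdet : H'.det ≠ 0)
    (hreg : IsGRegular (cmConjRingHom L) (Matrix.of fun i j : Fin 2 => if i.val + j.val + 1 = 2 then (1 : L) else 0) (Matrix.of fun i j : Fin 1 => if i.val + j.val + 1 = 1 then (1 : L) else 0) (Matrix.of fun i j : Fin 3 => if i.val + j.val + 1 = 3 then (1 : L) else 0) endoForm_antidiagOne γH)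
    (hP : ∀ᶠ v in cofinite, ∀ g g' : (UnitaryGroup.cmDatum L 3 H').Local v,
      g ∈ UnitaryGroup.cmLocalIntegralLevel L 3 H' v → g' ∈ UnitaryGroup.cmLocalIntegralLevel L 3 H' v →
        IsLocalNormPair L H' v (rationalComponent L γH v) g → IsLocalNormPair L H' v (rationalComponent L γH v) g' →
          ∃ k ∈ UnitaryGroup.cmLocalIntegralLevel L 3 H' v, k * g * k⁻¹ = g')
    [∀ g : (UnitaryGroup.cmDatum L 3 H').Adelic,
      MeasurableSpace ((UnitaryGroup.cmDatum L 3 H').Adelic ⧸ Subgroup.centralizer ({g} : Set (UnitaryGroup.cmDatum L 3 H').Adelic))]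
    (m : OrbitalMeasureFamily (UnitaryGroup.cmDatum L 3 H').Adelic) {E : Type*} [NormedAddCommGroup E] [NormedSpace ℝ E]
    {f : (UnitaryGroup.cmDatum L 3 H').Adelic → E} (hf : HasCompactSupport f) :
    (adelicStableClassesOver L H' γH ∩ Function.support (classOrbitalIntegral m f)).Finite := by
  refine (MatchingAdele.finite_setOf_mem_classes_inter_of_eventually hH hdet hreg hP hf.isCompact).subset ?_
  rintro c ⟨hc, hne⟩
  refine ⟨hc, ?_⟩
  by_contra hno
  refine hne ?_
  rw [classOrbitalIntegral_eq]
  refine orbitalIntegral_eq_zero_of_forall_notMem_tsupport _ _ fun g hg => hno ⟨g * Quotient.out c * g⁻¹, hg, ?_⟩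
  rw [← ConjClasses.mk_eq_mk_iff_isConj.2 (isConj_iff.2 ⟨g, rfl⟩), ← ConjClasses.quotient_mk_eq_mk, Quotient.out_eq]

/-- **… and so is every weighted (`κ`-twisted) summand** `c ↦ w c · Φ_m(c, f′)` (e.g. `w = κ ∘ obs`, the summand of ★ `adelicKappaOrbitalIntegralG'`, (4.3.3) ∕ (5.4.2)):
its support on `𝒞_𝐀(γ_H)` lies in that of `Φ_m(·, f′)`. [cite: Rogawski1990, §4.3 (4.3.3) p. 44; §5.4 (5.4.2) p. 72] -/
theorem MatchingAdele.finite_classes_inter_support_mul_classOrbitalIntegral_of_eventually (hH : (H'.map (cmConjRingHom L))ᵀ = H') (hdet : H'.det ≠ 0)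
    (hreg : IsGRegular (cmConjRingHom L) (Matrix.of fun i j : Fin 2 => if i.val + j.val + 1 = 2 then (1 : L) else 0) (Matrix.of fun i j : Fin 1 => if i.val + j.val + 1 = 1 then (1 : L) else 0) (Matrix.of fun i j : Fin 3 => if i.val + j.val + 1 = 3 then (1 : L) else 0) endoForm_antidiagOne γH)
    (hP : ∀ᶠ v in cofinite, ∀ g g' : (UnitaryGroup.cmDatum L 3 H').Local v,
      g ∈ UnitaryGroup.cmLocalIntegralLevel L 3 H' v → g' ∈ UnitaryGroup.cmLocalIntegralLevel L 3 H' v →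
        IsLocalNormPair L H' v (rationalComponent L γH v) g → IsLocalNormPair L H' v (rationalComponent L γH v) g' →
          ∃ k ∈ UnitaryGroup.cmLocalIntegralLevel L 3 H' v, k * g * k⁻¹ = g')
    [∀ g : (UnitaryGroup.cmDatum L 3 H').Adelic,
      MeasurableSpace ((UnitaryGroup.cmDatum L 3 H').Adelic ⧸ Subgroup.centralizer ({g} : Set (UnitaryGroup.cmDatum L 3 H').Adelic))]
    (m : OrbitalMeasureFamily (UnitaryGroup.cmDatum L 3 H').Adelic) (w : ConjClasses (UnitaryGroup.cmDatum L 3 H').Adelic → ℂ)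
    {f : (UnitaryGroup.cmDatum L 3 H').Adelic → ℂ} (hf : HasCompactSupport f) :
    (adelicStableClassesOver L H' γH ∩ Function.support fun c => w c * classOrbitalIntegral m f c).Finite := by
  refine (MatchingAdele.finite_classes_inter_support_classOrbitalIntegral_of_eventually hH hdet hreg hP m hf).subset ?_
  rintro c ⟨hc, hne⟩
  refine ⟨hc, fun h0 => hne ?_⟩
  show w c * classOrbitalIntegral m f c = 0
  rw [h0, mul_zero]

/-- The same for `f′ ∈ C_c(G′(𝐀), E)`. [cite: Rogawski1990, §4.3 p. 44; §5.4 p. 72] -/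
theorem MatchingAdele.finite_classes_inter_support_classOrbitalIntegral_cc_of_eventually (hH : (H'.map (cmConjRingHom L))ᵀ = H') (hdet : H'.det ≠ 0)
    (hreg : IsGRegular (cmConjRingHom L) (Matrix.of fun i j : Fin 2 => if i.val + j.val + 1 = 2 then (1 : L) else 0) (Matrix.of fun i j : Fin 1 => if i.val + j.val + 1 = 1 then (1 : L) else 0) (Matrix.of fun i j : Fin 3 => if i.val + j.val + 1 = 3 then (1 : L) else 0) endoForm_antidiagOne γH)
    (hP : ∀ᶠ v in cofinite, ∀ g g' : (UnitaryGroup.cmDatum L 3 H').Local v,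
      g ∈ UnitaryGroup.cmLocalIntegralLevel L 3 H' v → g' ∈ UnitaryGroup.cmLocalIntegralLevel L 3 H' v →
        IsLocalNormPair L H' v (rationalComponent L γH v) g → IsLocalNormPair L H' v (rationalComponent L γH v) g' →
          ∃ k ∈ UnitaryGroup.cmLocalIntegralLevel L 3 H' v, k * g * k⁻¹ = g')
    [∀ g : (UnitaryGroup.cmDatum L 3 H').Adelic,
      MeasurableSpace ((UnitaryGroup.cmDatum L 3 H').Adelic ⧸ Subgroup.centralizer ({g} : Set (UnitaryGroup.cmDatum L 3 H').Adelic))]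
    (m : OrbitalMeasureFamily (UnitaryGroup.cmDatum L 3 H').Adelic) {E : Type*} [NormedAddCommGroup E] [NormedSpace ℝ E]
    (f : CompactlySupportedContinuousMap (UnitaryGroup.cmDatum L 3 H').Adelic E) :
    (adelicStableClassesOver L H' γH ∩ Function.support (classOrbitalIntegral m f)).Finite :=
  MatchingAdele.finite_classes_inter_support_classOrbitalIntegral_of_eventually hH hdet hreg hP m f.hasCompactSupport

end FiniteGp

end Literature.NumberTheory.Rogawski1990
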